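import Summits.QuantumFields.GaugeBoot.ShiftDerivations
import HarnessLib

/-!
# The link Laplacian on a word space: every word observable is a constant plus a double shift derivative (gauge-boot, L1 supplement)

HONEST FRAMING (cell `pub-gaugeboot`, page 1 of every file): the venture produces certified bounds
on lattice expectations at stated coupling, gauge group, dimension and torus size; NOT a mass gap,
NOT a continuum limit, NOT a string tension; NOT Yang–Mills-summit-bearing (barriers
`FixedCouplingUltralocality`, `PerturbativeInvisibility`). Finite-dimensional linear algebra; no number.

## Content

The algebraic engine of the strong-coupling-order analysis of the truncated bootstrap. Fix an
exponential family of one-link shifts `ρ(k_a t) = e^{t X_a}` EXHAUSTING `G`, finitely many directions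
`gen m` whose generators span all `X_a`, a finite link set `S` and a degree `n`. On the
finite-dimensional word space `W = wordSpace r S n` (`WordSpaces`, `ShiftDerivations`) put the
**link Laplacian** `Δ = Σ_{i ∈ S} Σ_m D_{i,m} ∘ D_{i,m}` (`linkLaplacianL`; `D_{i,m} = sderivL … i (gen m)`).
Given a FAITHFUL `β = 0` functional `φ₀` — linear, killing every shift derivative of every polynomial
(the Schwinger–Dyson rows at `β = 0`, e.g. the product Haar state) and positive definite on
polynomial squares —

* `apply_laplacian_eq_zero` — `φ₀ (Δ g) = 0`; `apply_laplacian_mul_self` —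
  `φ₀ ((Δ v) v) = - Σ φ₀ ((D v)²)` (skewness of `D` under `φ₀` = Leibniz + rows);
* `sderiv_eq_zero_of_laplacian_eq_zero`, ★ `eq_const_of_laplacian_eq_zero` — `ker Δ` = constants
  (`ShiftDerivations.eq_const_of_forall_sderiv_eq_zero`); `laplacian_eq_zero_of_laplacian_laplacian_eq_zero`
  — `Δ` is injective on its range (a constant in the range of `Δ` has `φ₀`-mean `0`);
* ★★★ `exists_eq_const_add_laplacian` — **W = ℝ·1 ⊕ Δ(W)**: every `h ∈ wordSpace r S n` is
  `h = (φ₀ h / φ₀ 1)·1 + Σ_{i∈S} Σ_m D_{i,m}(D_{i,m} g)` for some `g ∈ wordSpace r S n` (an injective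
  endomorphism of the finite-dimensional `range Δ` is surjective).

Consequence (`StrongCouplingOrder.lean`): a functional satisfying the loop equations at `β = 0` up to
degree `n` is `φ 1 ·` Haar on `wordSpace r S n`; at `β ≠ 0` the difference of two solutions loses one
power of `β` per application. References: Yu. Makeenko, *Methods of contemporary gauge theory*
(2002) §12 Problem 12.7 (iterative strong-coupling solution of the loop equation); folklore.
-/

noncomputable section

open Filter Topology NormedSpace
open Literature.MathematicalPhysics.QuantumFieldTheory (LatticeRep)

namespace Summit.QuantumFields.GaugeBoot

variable {ι : Type*} [DecidableEq ι] {G : Type*} [Group G] [TopologicalSpace G] [ContinuousMul G]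
  {r : LatticeRep G} {K : Type*} {k : K → ℝ → G} {X : K → Matrix (Fin r.N) (Fin r.N) ℂ}
  (hk : ∀ a s t, k a (s + t) = k a s * k a t) (hX : ∀ a t, r.ρ (k a t) = exp ((t : ℂ) • X a))

/-! ## The link Laplacian -/

/-- **The link Laplacian** `Δ = Σ_{i ∈ S} Σ_m D_{i, gen m} ∘ D_{i, gen m}` on the word space
`wordSpace r S n` (a Casimir-type operator of the left action at the links of `S`). [folklore] -/
def linkLaplacianL (S : Finset ι) (n : ℕ) {M : ℕ} (gen : Fin M → K) :
    wordSpace r (S : Set ι) n →ₗ[ℝ] wordSpace r (S : Set ι) n :=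
  ∑ i ∈ S, ∑ m : Fin M,
    sderivL hk hX (S : Set ι) n i (gen m) ∘ₗ sderivL hk hX (S : Set ι) n i (gen m)

/-- The link Laplacian, as a function: the double sum of second derivatives. -/
theorem coe_linkLaplacianL (S : Finset ι) (n : ℕ) {M : ℕ} (gen : Fin M → K)
    (g : wordSpace r (S : Set ι) n) :
    ((linkLaplacianL hk hX S n gen g : wordSpace r (S : Set ι) n) : C(ι → G, ℝ)) =
      ∑ i ∈ S, ∑ m : Fin M, sderiv k i (gen m) (sderiv k i (gen m) (g : C(ι → G, ℝ))) := by
  simp only [linkLaplacianL, LinearMap.sum_apply, LinearMap.comp_apply, Submodule.coe_sum, coe_sderivL]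

/-! ## A faithful `β = 0` functional -/

section Faithful

variable {φ₀ : C(ι → G, ℝ) →ₗ[ℝ] ℝ}
  (hrow : ∀ (i : ι) (a : K), ∀ f ∈ polyAlgebra (ι := ι) r, φ₀ (sderiv k i a f) = 0)
  (hnn : ∀ f ∈ polyAlgebra (ι := ι) r, 0 ≤ φ₀ (f * f))
  (hfaith : ∀ f ∈ polyAlgebra (ι := ι) r, φ₀ (f * f) = 0 → f = 0)

include hrow in
/-- `φ₀` kills the Laplacian of everything. -/
theorem apply_laplacian_eq_zero (S : Finset ι) (n : ℕ) {M : ℕ} (gen : Fin M → K)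
    (g : wordSpace r (S : Set ι) n) :
    φ₀ ((linkLaplacianL hk hX S n gen g : wordSpace r (S : Set ι) n) : C(ι → G, ℝ)) = 0 := by
  rw [coe_linkLaplacianL, map_sum]
  refine Finset.sum_eq_zero fun i _ => ?_
  rw [map_sum]
  exact Finset.sum_eq_zero fun m _ => hrow i (gen m) _
    (sderiv_mem_polyAlgebra hk hX i (gen m) (mem_polyAlgebra_of_mem_wordSpace r g.2))

include hk hX hrow in
/-- **Skewness**: `φ₀ ((D D v) v) = - φ₀ ((D v)(D v))` (Leibniz and the `β = 0` row for `(D v) v`). -/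
theorem apply_sderiv_sderiv_mul (i : ι) (a : K) {v : C(ι → G, ℝ)} (hv : v ∈ polyAlgebra (ι := ι) r) :
    φ₀ (sderiv k i a (sderiv k i a v) * v) = -φ₀ (sderiv k i a v * sderiv k i a v) := by
  have hDv := sderiv_mem_polyAlgebra hk hX i a hv
  have h := hrow i a _ ((polyAlgebra (ι := ι) r).mul_mem hDv hv)
  rw [sderiv_mul hk hX i a hDv hv, map_add] at h
  linarith

include hrow in
/-- `φ₀ ((Δ v) v) = - Σ_{i ∈ S} Σ_m φ₀ ((D_{i,m} v)²)`. -/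
theorem apply_laplacian_mul_self (S : Finset ι) (n : ℕ) {M : ℕ} (gen : Fin M → K)
    (v : wordSpace r (S : Set ι) n) :
    φ₀ (((linkLaplacianL hk hX S n gen v : wordSpace r (S : Set ι) n) : C(ι → G, ℝ)) * v) =
      -∑ i ∈ S, ∑ m : Fin M,
        φ₀ (sderiv k i (gen m) (v : C(ι → G, ℝ)) * sderiv k i (gen m) (v : C(ι → G, ℝ))) := by
  rw [coe_linkLaplacianL, Finset.sum_mul, map_sum, ← Finset.sum_neg_distrib]
  refine Finset.sum_congr rfl fun i _ => ?_
  rw [Finset.sum_mul, map_sum, ← Finset.sum_neg_distrib]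
  exact Finset.sum_congr rfl fun m _ =>
    apply_sderiv_sderiv_mul hk hX hrow i (gen m) (mem_polyAlgebra_of_mem_wordSpace r v.2)

include hrow hnn hfaith in
/-- **`ker Δ ⊆ ⋂ ker D_{i,m}`**: if `Δ v = 0` then every `D_{i, gen m} v = 0`, `i ∈ S`. -/
theorem sderiv_eq_zero_of_laplacian_eq_zero (S : Finset ι) (n : ℕ) {M : ℕ} (gen : Fin M → K)
    {v : wordSpace r (S : Set ι) n} (hv : linkLaplacianL hk hX S n gen v = 0) {i : ι} (hi : i ∈ S)
    (m : Fin M) : sderiv k i (gen m) (v : C(ι → G, ℝ)) = 0 := by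
  have hvA := mem_polyAlgebra_of_mem_wordSpace r v.2
  have hsum : ∑ i ∈ S, ∑ m : Fin M,
      φ₀ (sderiv k i (gen m) (v : C(ι → G, ℝ)) * sderiv k i (gen m) (v : C(ι → G, ℝ))) = 0 := by
    have h := apply_laplacian_mul_self hk hX hrow S n gen v
    rw [hv, Submodule.coe_zero, zero_mul, map_zero] at h
    linarith
  have hnn' : ∀ i ∈ S, ∀ m ∈ (Finset.univ : Finset (Fin M)),
      0 ≤ φ₀ (sderiv k i (gen m) (v : C(ι → G, ℝ)) * sderiv k i (gen m) (v : C(ι → G, ℝ))) :=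
    fun i _ m _ => hnn _ (sderiv_mem_polyAlgebra hk hX i (gen m) hvA)
  have h1 := (Finset.sum_eq_zero_iff_of_nonneg fun i hi => Finset.sum_nonneg (hnn' i hi)).1 hsum i hi
  have h2 := (Finset.sum_eq_zero_iff_of_nonneg (hnn' i hi)).1 h1 m (Finset.mem_univ m)
  exact hfaith _ (sderiv_mem_polyAlgebra hk hX i (gen m) hvA) h2

include hrow hnn hfaith in
/-- ★ **`ker Δ` = constants** (given exhaustion and spanning directions). -/
theorem eq_const_of_laplacian_eq_zero (hexh : ∀ g : G, ∃ a t, k a t = g) (S : Finset ι) (n : ℕ)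
    {M : ℕ} (gen : Fin M → K) (hspan : ∀ a, X a ∈ Submodule.span ℝ (Set.range fun m => X (gen m)))
    {v : wordSpace r (S : Set ι) n} (hv : linkLaplacianL hk hX S n gen v = 0) :
    (v : C(ι → G, ℝ)) = algebraMap ℝ C(ι → G, ℝ) ((v : C(ι → G, ℝ)) 1) :=
  eq_const_of_forall_sderiv_eq_zero hk hX hexh gen hspan S.finite_toSet v.2
    fun _ hi m => sderiv_eq_zero_of_laplacian_eq_zero hk hX hrow hnn hfaith S n gen hv hi m

include hfaith in
omit [DecidableEq ι] [ContinuousMul G] in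
/-- A faithful functional does not vanish at `1`. -/
theorem apply_one_ne_zero : φ₀ 1 ≠ 0 := fun h => by
  have h1 : (1 : C(ι → G, ℝ)) = 0 :=
    hfaith 1 (polyAlgebra (ι := ι) r).one_mem (by rwa [mul_one])
  have := congrArg (fun f : C(ι → G, ℝ) => f 1) h1
  simp at this

include hrow hnn hfaith in
/-- **`Δ` is injective on its range**: `Δ (Δ g) = 0 ⇒ Δ g = 0` (a constant in the range of `Δ` has
`φ₀`-mean zero, and `φ₀ 1 ≠ 0`). -/
theorem laplacian_eq_zero_of_laplacian_laplacian_eq_zero (hexh : ∀ g : G, ∃ a t, k a t = g)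
    (S : Finset ι) (n : ℕ) {M : ℕ} (gen : Fin M → K)
    (hspan : ∀ a, X a ∈ Submodule.span ℝ (Set.range fun m => X (gen m)))
    {g : wordSpace r (S : Set ι) n}
    (hg : linkLaplacianL hk hX S n gen (linkLaplacianL hk hX S n gen g) = 0) :
    linkLaplacianL hk hX S n gen g = 0 := by
  set w := linkLaplacianL hk hX S n gen g with hw
  have hconst := eq_const_of_laplacian_eq_zero hk hX hrow hnn hfaith hexh S n gen hspan hg
  have hmean : φ₀ (w : C(ι → G, ℝ)) = 0 := apply_laplacian_eq_zero hk hX hrow S n gen g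
  rw [hconst, Algebra.algebraMap_eq_smul_one, map_smul, smul_eq_mul] at hmean
  have hc : (w : C(ι → G, ℝ)) 1 = 0 := by
    rcases mul_eq_zero.1 hmean with h | h
    · exact h
    · exact (apply_one_ne_zero hfaith h).elim
  apply Subtype.ext
  rw [hconst, hc, map_zero, Submodule.coe_zero]

/-- **Linear algebra**: an endomorphism `Δ` of a finite-dimensional space which is injective on its
range (`Δ (Δ g) = 0 ⇒ Δ g = 0`) maps its range ONTO its range: every `Δ h` is a `Δ (Δ g)`
(rank–nullity for `Δ` and `Δ ∘ Δ`). [folklore] -/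
theorem exists_apply_apply_eq {V : Type*} [AddCommGroup V] [Module ℝ V] [FiniteDimensional ℝ V]
    (Δ : V →ₗ[ℝ] V) (hkey : ∀ g, Δ (Δ g) = 0 → Δ g = 0) (h : V) : ∃ g, Δ (Δ g) = Δ h := by
  have hker : LinearMap.ker (Δ ∘ₗ Δ) = LinearMap.ker Δ := by
    refine le_antisymm (fun g hg => ?_) (fun g hg => ?_)
    · rw [LinearMap.mem_ker] at hg ⊢
      exact hkey g hg
    · rw [LinearMap.mem_ker] at hg ⊢
      rw [LinearMap.comp_apply, hg, map_zero]
  have h1 := LinearMap.finrank_range_add_finrank_ker (Δ ∘ₗ Δ)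
  have h2 := LinearMap.finrank_range_add_finrank_ker Δ
  rw [hker] at h1
  have heq : LinearMap.range (Δ ∘ₗ Δ) = LinearMap.range Δ :=
    Submodule.eq_of_le_of_finrank_eq (LinearMap.range_comp_le_range _ _) (by omega)
  have hm : Δ h ∈ LinearMap.range (Δ ∘ₗ Δ) := by rw [heq]; exact LinearMap.mem_range_self Δ h
  obtain ⟨g, hg⟩ := LinearMap.mem_range.1 hm
  exact ⟨g, hg⟩

include hk hX hrow hnn hfaith in
/-- ★★★ **`W = ℝ·1 ⊕ Δ(W)`: every element of the word space is a constant plus a Laplacian.** For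
every `h ∈ wordSpace r S n` (`S` finite) there is `g ∈ wordSpace r S n` with
`h = (φ₀ h / φ₀ 1) · 1 + Σ_{i ∈ S} Σ_m D_{i, gen m} (D_{i, gen m} g)`.
(Finite-dimensionality of the word space; `Δ` injective on its range, hence onto it;
`ker Δ` = constants.) [folklore] -/
theorem exists_eq_const_add_laplacian (hexh : ∀ g : G, ∃ a t, k a t = g) (S : Finset ι) (n : ℕ)
    {M : ℕ} (gen : Fin M → K) (hspan : ∀ a, X a ∈ Submodule.span ℝ (Set.range fun m => X (gen m)))
    {h : C(ι → G, ℝ)} (hh : h ∈ wordSpace r (S : Set ι) n) :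
    ∃ g ∈ wordSpace r (S : Set ι) n,
      h = (φ₀ h / φ₀ 1) • (1 : C(ι → G, ℝ)) +
        ∑ i ∈ S, ∑ m : Fin M, sderiv k i (gen m) (sderiv k i (gen m) g) := by
  haveI : FiniteDimensional ℝ (wordSpace r (S : Set ι) n) :=
    finiteDimensional_wordSpace r S.finite_toSet n
  set Δ := linkLaplacianL hk hX S n gen with hΔ
  -- solve `Δ (Δ g) = Δ h`
  obtain ⟨g, hΔg⟩ := exists_apply_apply_eq Δ
    (fun g hg => laplacian_eq_zero_of_laplacian_laplacian_eq_zero hk hX hrow hnn hfaith hexh S n gen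
      hspan hg) ⟨h, hh⟩
  -- `h - Δ g` is in the kernel, hence constant
  have hker : Δ (⟨h, hh⟩ - Δ g) = 0 := by rw [map_sub, hΔg, sub_self]
  have hconst := eq_const_of_laplacian_eq_zero hk hX hrow hnn hfaith hexh S n gen hspan hker
  set c := ((⟨h, hh⟩ - Δ g : wordSpace r (S : Set ι) n) : C(ι → G, ℝ)) 1 with hc
  have hdec : h = c • (1 : C(ι → G, ℝ)) + ((Δ g : wordSpace r (S : Set ι) n) : C(ι → G, ℝ)) := by
    have h1 : h - ((Δ g : wordSpace r (S : Set ι) n) : C(ι → G, ℝ)) =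
        algebraMap ℝ C(ι → G, ℝ) c := by simpa using hconst
    rw [Algebra.algebraMap_eq_smul_one] at h1
    rw [← h1, sub_add_cancel]
  -- identify the constant
  have hmean : φ₀ h = c * φ₀ 1 := by
    have := congrArg φ₀ hdec
    rwa [map_add, apply_laplacian_eq_zero hk hX hrow S n gen g, add_zero, map_smul, smul_eq_mul] at this
  have hc' : c = φ₀ h / φ₀ 1 := by
    rw [hmean, mul_div_cancel_right₀ _ (apply_one_ne_zero hfaith)]
  refine ⟨g, g.2, ?_⟩
  rw [← coe_linkLaplacianL hk hX S n gen g, ← hc']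
  exact hdec

end Faithful

end Summit.QuantumFields.GaugeBoot

end
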